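import Summits.ABC.ABC.Theses.IsogenyGlueCongruence
import Literature.NumberTheory.EllipticCurves.ManinConstantPotMultiplicativeProofs
import Literature.NumberTheory.EllipticCurves.ManinConstantFiniteHeightPrimesProofs
import Summits.ABC.ABC.Theorems.IsogenyGlueCongruenceMazurKenkuBoundStubFlexAlgebra
import Summits.ABC.ABC.Theorems.IsogenyGlueCongruenceMazurKenkuBoundStubFlexNorms
import Summits.ABC.ABC.Theorems.IsogenyGlueCongruenceMazurKenkuBoundStubPotGoodTwo
import Summits.ABC.ABC.Theorems.IsogenyGlueCongruenceMazurKenkuBoundStubFiniteHeightThree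
import Summits.ABC.ABC.Theorems.IsogenyGlueCongruenceMazurKenkuBoundStubTwoTorsionNorms
import Summits.ABC.ABC.Theorems.IsogenyGlueCongruenceMazurKenkuBoundStubPotGoodThree
import HarnessLib

/-!
# Route `IsogenyGlueCongruence`, crux `MazurKenkuBound` (stmt-ABC-15125), line `Sketch` — the
# Edixhoven input DISCHARGED: `EdixhovenIntegrality` (stmt-ABC-15990) and the Literature fact
# `edixhoven_int_of_neronLattice_eq_smul_periodLattice` are theorems

Lead c19 (2026-08-17). The crux `MazurKenkuBound` is the join of the sibling cruxes stmt-ABC-15193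
(`MazurKenkuRadius`, Mazur 1978 Thm. 1 + Kenku 1982) and stmt-ABC-15990 (`EdixhovenIntegrality` =
Edixhoven 1991, Prop. 2 in lattice form: a globally minimal `W'/ℚ` with newform `f` and Néron period
pair `L'` with `Λ_{L'} = qΛ_f` exactly has `q ∈ ℤ`). This file closes the SECOND: the tree proves
`‖q‖_p ≤ 1` at every non-additive prime (`ManinConstantFiniteHeightPrimesProofs`), at the potentially
multiplicative additive `2` and `3` (`ManinConstantPotMultiplicativeProofs`), and — the six landed
stubs of this line's wave 1 — at the potentially GOOD additive `2` (flex model: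
`stub_flexAlgebra`, `stub_flexNorms`, `stub_potGoodTwo`) and `3` (one 2-torsion point:
`stub_finiteHeightThree`, `stub_twoTorsionNorms`, `stub_potGoodThree`, the last through the facts
seat's Legendre twist `…_of_norm_j_le_one_three`); since every prime factor of `den q` is an additive
`2` or `3` (`eq_two_or_eq_three_and_additive_of_dvd_den_…`), `den q = 1`.

* `edixhoven_int_of_neronLattice_eq_smul_periodLattice_of_flexLine` — the Literature fact, proved;
* `edixhovenIntegrality_proof : Summit.ABC.ABC.Theses.IsogenyGlueCongruence.EdixhovenIntegrality` —
  the route item stmt-ABC-15990, literally (definitionally the fact).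

No Néron models, no `X₀(N)_ℤ`: the whole proof is the finite-height / Honda / Newton-polygon route
recorded in the docstring of the fact (`NeronIsogenyScaling.lean`).

## References

* B. Edixhoven, *On the Manin constants of modular elliptic curves*, in: Arithmetic Algebraic
  Geometry (Texel, 1989), Progr. Math. 89 (1991), 25–39, Prop. 2. [EdixhovenManin1991]
* A. Agashe, K. Ribet, W. Stein, *The Manin constant*, Pure Appl. Math. Q. 2 (2006), Thm. 2.2.
  [AgasheRibetStein2006]
-/

-- `Summit.<Summit>.<Problem>` is the mandated summit-side namespace (CONVENTIONS §2); for the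
-- single-conjunct summit `ABC` the two coincide, so the duplicate `ABC.ABC` is deliberate.
set_option linter.dupNamespace false

noncomputable section

open scoped MatrixGroups ModularForm Classical

open CongruenceSubgroup
open WeierstrassCurve
open Literature.NumberTheory.EllipticCurves
open Literature.NumberTheory.EllipticCurves.ModularForms

namespace Summit.ABC.ABC.Theorems

/-- `p ∣ den q` gives `‖q‖_p > 1`. [folklore] -/
theorem one_lt_padicNorm_of_dvd_den {p : ℕ} [hp : Fact p.Prime] {q : ℚ} (hpq : p ∣ q.den) :
    1 < ‖(q : ℚ_[p])‖ := by
  have hqden : ‖((q.den : ℤ) : ℚ_[p])‖ < 1 :=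
    Padic.norm_intCast_lt_one_iff.mpr (Int.natCast_dvd_natCast.mpr hpq)
  have hnum : ‖((q.num : ℤ) : ℚ_[p])‖ = 1 := by
    refine le_antisymm (Padic.norm_int_le_one _) (not_lt.mp fun h ↦ ?_)
    have hpn : p ∣ q.num.natAbs := Int.natCast_dvd.mp (Padic.norm_intCast_lt_one_iff.mp h)
    have h1 : p ∣ 1 := by
      have h' := Nat.dvd_gcd hpn hpq
      rwa [Nat.Coprime.gcd_eq_one q.reduced] at h'
    exact hp.out.ne_one (Nat.dvd_one.mp h1)
  have hq' : (q : ℚ_[p]) = ((q.num : ℤ) : ℚ_[p]) / ((q.den : ℤ) : ℚ_[p]) := by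
    rw [Int.cast_natCast, ← Rat.cast_intCast, ← Rat.cast_natCast, ← Rat.cast_div, Rat.num_div_den]
  have hden0 : 0 < ‖((q.den : ℤ) : ℚ_[p])‖ := by
    rw [norm_pos_iff, Int.cast_natCast, Nat.cast_ne_zero]
    exact q.den_nz
  rw [hq', norm_div, hnum, one_div, one_lt_inv₀ hden0]
  exact hqden

/-- **`‖q‖₂ ≤ 1` for every datum of Edixhoven's fact** (the prime `2` in all cases): non-additive
(`…_of_not_additive'`), potentially multiplicative additive (`…_of_one_lt_norm_j_two`), potentially
good additive (`stub_potGoodTwo` fed with `stub_flexAlgebra`, `stub_flexNorms`).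
[cite: EdixhovenManin1991, Prop. 2] -/
theorem padicNorm_two_le_one_of_neronLattice_eq_smul_periodLattice {N : ℕ} [NeZero N]
    {W' : WeierstrassCurve ℚ} [W'.IsElliptic] [W'.IsGloballyMinimal] {f : CuspForm (Gamma0 N) 2}
    {L' : PeriodPair} (hf : IsNewformOf W' f) (hL' : IsNeronLatticeOf (W'.baseChange ℂ) L')
    {q : ℚ} (hq : ∀ z ∈ periodLattice f, (q : ℂ) * z ∈ L'.lattice)
    (hq' : ∀ z ∈ L'.lattice, ∃ w ∈ periodLattice f, z = q * w) : ‖(q : ℚ_[2])‖ ≤ 1 := by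
  haveI h2p : Fact (Nat.Prime 2) := ⟨Nat.prime_two⟩
  by_cases hadd : (2 : ℤ) ∣ minimalDiscriminantInt W' ∧ (2 : ℤ) ∣ (integralModelInt W').c₄
  · rcases lt_or_ge 1 ‖((W'.j : ℚ) : ℚ_[2])‖ with hj | hj
    · exact padicNorm_le_one_of_neronLattice_eq_smul_periodLattice_of_one_lt_norm_j_two hf hL' hq
        hq' hadd.1 hadd.2 hj
    · exact stub_potGoodTwo stub_flexAlgebra stub_flexNorms hf hL' hq hq' hadd.1 hadd.2 hj
  · exact padicNorm_le_one_of_neronLattice_eq_smul_periodLattice_of_not_additive' hf hL' hq hq'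
      (p := 2) (by exact_mod_cast hadd)

/-- **`‖q‖₃ ≤ 1` for every datum of Edixhoven's fact** (the prime `3` in all cases), through the
line's stubs at `3` (`stub_potGoodThree` fed with `stub_finiteHeightThree`, `stub_twoTorsionNorms`;
the tree's `padicNorm_three_le_one_of_neronLattice_eq_smul_periodLattice` is the same conclusion).
[cite: EdixhovenManin1991, Prop. 2] -/
theorem padicNorm_three_le_one_of_neronLattice_eq_smul_periodLattice' {N : ℕ} [NeZero N]
    {W' : WeierstrassCurve ℚ} [W'.IsElliptic] [W'.IsGloballyMinimal] {f : CuspForm (Gamma0 N) 2}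
    {L' : PeriodPair} (hf : IsNewformOf W' f) (hL' : IsNeronLatticeOf (W'.baseChange ℂ) L')
    {q : ℚ} (hq : ∀ z ∈ periodLattice f, (q : ℂ) * z ∈ L'.lattice)
    (hq' : ∀ z ∈ L'.lattice, ∃ w ∈ periodLattice f, z = q * w) : ‖(q : ℚ_[3])‖ ≤ 1 := by
  haveI h3p : Fact (Nat.Prime 3) := ⟨Nat.prime_three⟩
  by_cases hadd : (3 : ℤ) ∣ minimalDiscriminantInt W' ∧ (3 : ℤ) ∣ (integralModelInt W').c₄
  · rcases lt_or_ge 1 ‖((W'.j : ℚ) : ℚ_[3])‖ with hj | hj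
    · exact padicNorm_le_one_of_neronLattice_eq_smul_periodLattice_of_one_lt_norm_j_three hf hL' hq
        hq' hadd.1 hadd.2 hj
    · exact stub_potGoodThree stub_finiteHeightThree stub_twoTorsionNorms hf hL' hq hq' hadd.1
        hadd.2 hj
  · exact padicNorm_le_one_of_neronLattice_eq_smul_periodLattice_of_not_additive' hf hL' hq hq'
      (p := 3) (by exact_mod_cast hadd)

/-- **Edixhoven 1991, Prop. 2 in lattice form — the Literature fact
`edixhoven_int_of_neronLattice_eq_smul_periodLattice`, PROVED**: `‖q‖_p ≤ 1` at `p = 2` and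
`p = 3` in every case (above), while every prime factor of `den q` is `2` or `3`
(`eq_two_or_eq_three_and_additive_of_dvd_den_…`); so `den q = 1`. No Néron models and no
`X₀(N)_ℤ`: the finite-height / Honda / Newton-polygon route of the fact's docstring, end to end.
[cite: EdixhovenManin1991, Prop. 2] [cite: AgasheRibetStein2006, Thm. 2.2] -/
theorem edixhoven_int_of_neronLattice_eq_smul_periodLattice_of_flexLine :
    edixhoven_int_of_neronLattice_eq_smul_periodLattice := by
  intro N _ W' _ _ f L' hf hL' q hq hq'
  have h2 := padicNorm_two_le_one_of_neronLattice_eq_smul_periodLattice hf hL' hq hq'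
  have h3 := padicNorm_three_le_one_of_neronLattice_eq_smul_periodLattice' hf hL' hq hq'
  have hden : q.den = 1 := by
    by_contra hne
    obtain ⟨p, hp, hpq⟩ := Nat.exists_prime_and_dvd hne
    obtain ⟨h23, -, -⟩ :=
      eq_two_or_eq_three_and_additive_of_dvd_den_of_neronLattice_eq_smul_periodLattice hf hL' hq hq'
        hp hpq
    rcases h23 with rfl | rfl
    · exact absurd h2 (not_le.mpr (one_lt_padicNorm_of_dvd_den (hp := ⟨hp⟩) hpq))
    · exact absurd h3 (not_le.mpr (one_lt_padicNorm_of_dvd_den (hp := ⟨hp⟩) hpq))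
  exact ⟨q.num, Rat.coe_int_num_of_den_eq_one hden⟩

/-- **The route item `EdixhovenIntegrality` (stmt-ABC-15990), proved** — definitionally the
Literature fact just discharged. This closes the Edixhoven input of the crux `MazurKenkuBound`
(stmt-ABC-15125): the crux is now `MazurKenkuRadius` (stmt-ABC-15193) alone, by the landed
`mazurKenkuBound_of_radiusItem_of_edixhovenItem`. [cite: EdixhovenManin1991, Prop. 2] -/
theorem edixhovenIntegrality_proof : Summit.ABC.ABC.Theses.IsogenyGlueCongruence.EdixhovenIntegrality :=
  edixhoven_int_of_neronLattice_eq_smul_periodLattice_of_flexLine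

end Summit.ABC.ABC.Theorems

end
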